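import Summits.AnomalousDissipation.AnomalousDissipation.Theorems.BaireTransferDenseLoudDesignerForcesErgodicModelSemigroup
import Summits.AnomalousDissipation.AnomalousDissipation.Theorems.BaireTransferDenseLoudDesignerForcesErgodicFramePreimage
import Literature.Analysis.FunctionSpaces.TorusEnstrophyPeterPaul
import Literature.Analysis.FunctionSpaces.TorusLinearisedNSEnergy
import Literature.Analysis.FunctionSpaces.TorusLinearisedFormTruncation
import Literature.Analysis.InnerProduct.HilbertBasisCoordinateConvergence
import Literature.Analysis.UnboundedOperators.SemilinearMildTubeCover

/-!
# Frame norms of physical states and Lipschitz dependence of mild solutions (block N, S6g helpers,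
# line `ergodic-budget-selection-closing`, crux `BaireTransfer.DenseLoudDesignerForces`, stmt-AnomalousDissipation-1143)

Summit-side plumbing over the ACCEPTED definitions `ModelFrame`, `ModelFrame.IsMild` (`…ErgodicModelDefs.lean`) for the
identification of model orbits with classical Navier–Stokes trajectories (tools stub S6g `stub_closedOrbitClassicalTools`):

* `ModelFrame.exists_forall_isMild_norm_sub_le` — Lipschitz dependence of bounded mild solutions of the frame-conjugated
  equation on the datum (Henry 1981, Thm. 3.4.1 = the tree's `exists_forall_norm_sub_le_of_mild`);
* `ModelFrame.norm_sq_eq_of_apply_eq_stateOf` — the frame norm of the preimage of an honest state: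
  `F.S y = [v]` ⇒ `‖y‖² = ∫‖v‖² + ‖∇v‖₂²` (`y = S([v] − [Δv])`, Parseval in the mode basis, Green's identity);
* `ModelFrame.ofReal_norm_sq_add_eGradNormSq_le` — the frame bound read on states: `‖F.S y‖² + ‖∇ rep(F.S y)‖₂² ≤ ‖y‖²`
  (`Torus.tsum_one_add_stokesEigenvalue_mul_enorm_sq_le`, vector Parseval, `eGradNormSq_eq_tsum`);
* `ModelFrame.tendsto_of_tendsto_stateOf` — frame preimages `Y s` of the states of fields `w s` attaining `rep (F.S y)` in
  `L²` and in `Ḣ¹` converge to `y` in `H` (the two previous items feed the Radon–Riesz lemma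
  `tendsto_of_forall_inner_hilbertBasis_tendsto` with the Peter–Paul bound `Torus.eGradNormSq_le_add_mul_eGradNormSq_sub`);
* `stub_mildOrbitIdentificationTools` — IDENTIFICATION: a bounded mild solution `ζ` from `y` and a classical solution `w`
  on `(0, L]` attaining `rep (F.S y)` in `L²` and `Ḣ¹` with bounded enstrophy have `F.S (ζ s) = [w s]` on `(0, L] ∩ [0, τ]`
  (S5b: the frame curve `Y` of `w` is mild on every `[ε, L]`; Lipschitz dependence on the datum on `[ε, s]` and `ε → 0⁺`
  with `ζ ε → y`, `Y ε → y`).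

References: D. Henry, *Geometric Theory of Semilinear Parabolic Equations*, LNM 840 (1981), Thm. 3.4.1; P. Constantin,
C. Foias, *Navier–Stokes Equations* (1988), Ch. 4 (4.11)–(4.13) (`V = D(A^{1/2})`, `‖v‖_V² = |v|² + ‖v‖²`).  Nothing is
asserted; no definition is added.
-/

set_option linter.dupNamespace false

noncomputable section

open Set Function MeasureTheory Filter
open scoped InnerProductSpace RealInnerProductSpace Topology ENNReal

namespace Summit.AnomalousDissipation.AnomalousDissipation.Theorems.DenseLoudDesignerForces.Ergodic

open Literature.Analysis.FunctionSpaces Literature.Analysis.FunctionSpaces.Torus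
open Literature.Analysis.FluidPDE Literature.Analysis.FluidPDE.Torus
open Summit.AnomalousDissipation.AnomalousDissipation.Theses.BaireTransfer
open Summit.AnomalousDissipation.AnomalousDissipation.Theorems.DenseLoudDesignerForces.Negative
open Literature.Analysis.UnboundedOperators

namespace ModelFrame

/-! ## Lipschitz dependence of mild solutions on the datum -/

/-- **Lipschitz dependence of bounded mild solutions of the frame-conjugated equation on the datum** (Henry 1981, Thm. 3.4.1):
for `ν > 0` and reals `R`, `L` there is `Lip ≥ 1` such that two mild solutions on `[0, t]`, `t ≤ L`, from `x₁`, `x₂`, both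
bounded by `R`, satisfy `‖z₁ r − z₂ r‖ ≤ Lip ‖x₁ − x₂‖` (the tree's `exists_forall_norm_sub_le_of_mild` for the rescaled
families `T(ν·)`, `K(ν·)`, read for curves on compact intervals). [folklore] -/
theorem exists_forall_isMild_norm_sub_le (F : ModelFrame) {ν : ℝ} (hν : 0 < ν) (xf : Hsp) (R L : ℝ) :
    ∃ Lip : ℝ, 1 ≤ Lip ∧ ∀ {t : ℝ} (ht : 0 ≤ t), t ≤ L → ∀ {x₁ x₂ : Hsp} {z₁ z₂ : C(Icc (0 : ℝ) t, Hsp)},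
      F.IsMild ν xf ht x₁ z₁ → F.IsMild ν xf ht x₂ z₂ → (∀ r, ‖z₁ r‖ ≤ R) → (∀ r, ‖z₂ r‖ ≤ R) →
      ∀ r, ‖z₁ r - z₂ r‖ ≤ Lip * ‖x₁ - x₂‖ := by
  obtain ⟨Lip, hLip1, hLip⟩ := exists_forall_norm_sub_le_of_mild (fun r => F.T (ν * r)) (fun r => F.K (ν * r))
    (F.norm_T_mul_le hν.le) (α := 3 / 4) (C := ν ^ (-(3 / 4 : ℝ))) (by norm_num) (Real.rpow_nonneg hν.le _)
    (F.norm_K_mul_le hν) (F.continuousOn_K_mul hν) F.Nb xf R L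
  refine ⟨Lip, hLip1, fun {t} ht htL {x₁ x₂ z₁ z₂} h₁ h₂ hb₁ hb₂ r => ?_⟩
  have hc : ∀ z : C(Icc (0 : ℝ) t, Hsp), Continuous fun s => z (projIcc 0 t ht s) := fun z =>
    z.continuous.comp continuous_projIcc
  have hm : ∀ (x : Hsp) (z : C(Icc (0 : ℝ) t, Hsp)), F.IsMild ν xf ht x z →
      ∀ r ∈ Icc 0 t, z (projIcc 0 t ht r) = F.T (ν * r) x + (∫ s in (0 : ℝ)..r, F.T (ν * (r - s)) xf) -
        ∫ s in (0 : ℝ)..r, F.K (ν * (r - s)) (F.Nb (z (projIcc 0 t ht s)) (z (projIcc 0 t ht s))) := by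
    intro x z hz r hr
    rw [projIcc_of_mem ht hr]
    exact hz ⟨r, hr⟩
  have h := hLip t htL _ _ x₁ x₂ (hc z₁) (hc z₂) (hm x₁ z₁ h₁) (hm x₂ z₂ h₂) (fun r _ => hb₁ _) (fun r _ => hb₂ _) r r.2
  rwa [projIcc_val ht r] at h

/-! ## Frame norms of honest states -/

/-- **The frame norm of the preimage of an honest state is its `H¹` graph norm**: if `v` is smooth, divergence free and mean
zero and `F.S y = [v]`, then `‖y‖² = ∫‖v‖² + ‖∇v‖₂²`.  Indeed `y = S([v] − [Δv])` (`eq_frame_apply_of_frame_apply_eq_stateOf`),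
so modewise `⟪b i, y⟫² = (1 + m_i) ⟪b i, [v]⟫² = ⟪b i, [v]⟫ ⟪b i, [v] − [Δv]⟫`, and Parseval in the mode basis gives
`‖y‖² = ⟪[v], [v] − [Δv]⟫ = ∫‖v‖² − ∫⟪v, Δv⟫ = ∫‖v‖² + ‖∇v‖₂²` (Constantin–Foias 1988, (4.12)). [folklore] -/
theorem norm_sq_eq_of_apply_eq_stateOf (F : ModelFrame) {v : (UnitAddTorus (Fin 3)) → (EuclideanSpace ℝ (Fin 3))}
    (hv : IsSmooth v) (hd : IsDivFree v) (hm : HasZeroMean v) {y : Hsp} (hy : F.S y = stateOf v) :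
    ‖y‖ ^ 2 = (∫ x, ‖v x‖ ^ 2) + gradNormSq v := by
  have hyeq := eq_frame_apply_of_frame_apply_eq_stateOf F.b F.hmodes F.hS hv hd hm hy
  have hΔd : IsDivFree (laplacian v) := IsDivFree.laplacian_of_isSmooth hv hd
  have hΔm : HasZeroMean (laplacian v) := integral_laplacian_eq_zero_of_isSmooth hv
  have hcoef : ∀ i, ⟪y, F.b i⟫_ℝ * ⟪F.b i, y⟫_ℝ =
      ⟪stateOf v, F.b i⟫_ℝ * ⟪F.b i, stateOf v - stateOf (laplacian v)⟫_ℝ := by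
    intro i
    obtain ⟨k, a, c, -, -, -, hcoe, hmi⟩ := F.hmodes i
    have hm0 : 0 ≤ F.m i := hmi ▸ stokesEigenvalue_nonneg k
    have h1p : 0 < 1 + F.m i := by linarith
    have h1 : ⟪F.b i, y⟫_ℝ = (1 + F.m i) ^ (-(1 / 2 : ℝ)) * ⟪F.b i, stateOf v - stateOf (laplacian v)⟫_ℝ := by
      rw [hyeq]
      exact inner_basis_apply_of_apply_basis F.b F.hS _ i
    have hv' : ⟪F.b i, stateOf v⟫_ℝ = ∫ x, ⟪v x, stokesMode k a c x⟫_ℝ := inner_stateOf_right_of_coe_eq hv hd hm hcoe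
    have hΔ : ⟪F.b i, stateOf (laplacian v)⟫_ℝ = -(stokesEigenvalue k * ∫ x, ⟪v x, stokesMode k a c x⟫_ℝ) :=
      inner_stateOf_laplacian_right_of_coe_eq hv hd hcoe
    have hσ : (1 + F.m i) * ((1 + F.m i) ^ (-(1 / 2 : ℝ)) * (1 + F.m i) ^ (-(1 / 2 : ℝ))) = 1 := by
      rw [← Real.rpow_add h1p, show -(1 / 2 : ℝ) + -(1 / 2 : ℝ) = -1 by norm_num, Real.rpow_neg_one,
        mul_inv_cancel₀ h1p.ne']
    rw [real_inner_comm (F.b i) y, real_inner_comm (F.b i) (stateOf v), h1, inner_sub_right, hv', hΔ, ← hmi]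
    set I := ∫ x, ⟪v x, stokesMode k a c x⟫_ℝ
    have e : I - -(F.m i * I) = (1 + F.m i) * I := by ring
    rw [e]
    calc (1 + F.m i) ^ (-(1 / 2 : ℝ)) * ((1 + F.m i) * I) * ((1 + F.m i) ^ (-(1 / 2 : ℝ)) * ((1 + F.m i) * I))
        = (1 + F.m i) * ((1 + F.m i) ^ (-(1 / 2 : ℝ)) * (1 + F.m i) ^ (-(1 / 2 : ℝ))) * ((1 + F.m i) * I * I) := by
          ring
      _ = I * ((1 + F.m i) * I) := by rw [hσ]; ring
  have hs1 := F.b.hasSum_inner_mul_inner y y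
  have hs2 := F.b.hasSum_inner_mul_inner (stateOf v) (stateOf v - stateOf (laplacian v))
  have heq : ⟪y, y⟫_ℝ = ⟪stateOf v, stateOf v - stateOf (laplacian v)⟫_ℝ := by
    refine hs1.unique ?_
    have hf : (fun i => ⟪stateOf v, F.b i⟫_ℝ * ⟪F.b i, stateOf v - stateOf (laplacian v)⟫_ℝ) =
        fun i => ⟪y, F.b i⟫_ℝ * ⟪F.b i, y⟫_ℝ := funext fun i => (hcoef i).symm
    rw [← hf]
    exact hs2
  have hrep : ∫ x, ⟪v x, rep (stateOf (laplacian v)) x⟫_ℝ = ∫ x, ⟪v x, laplacian v x⟫_ℝ := by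
    refine integral_congr_ae ?_
    filter_upwards [rep_stateOf hv.laplacian hΔd hΔm] with x hx
    rw [hx]
  rw [← real_inner_self_eq_norm_sq, heq, inner_sub_right, real_inner_self_eq_norm_sq, norm_stateOf_sq hv hd hm,
    inner_stateOf_left hv hd hm, hrep, integral_congr_ae (ae_of_all _ fun x => real_inner_comm (laplacian v x) (v x)),
    integral_inner_laplacian_self_eq_neg_gradNormSq_of_isSmooth hv]
  ring

/-- **The frame bound read on states**: for every `y ∈ H`, `‖F.S y‖² + ‖∇ rep (F.S y)‖₂² ≤ ‖y‖²` (spectral enstrophy;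
`Torus.tsum_one_add_stokesEigenvalue_mul_enorm_sq_le` split by Parseval `∑‖𝓕‖² = ‖·‖²` and `eGradNormSq_eq_tsum`). [folklore] -/
theorem ofReal_norm_sq_add_eGradNormSq_le (F : ModelFrame) (y : Hsp) :
    ENNReal.ofReal (‖F.S y‖ ^ 2) + eGradNormSq (rep (F.S y)) ≤ ENNReal.ofReal (‖y‖ ^ 2) := by
  have hb : ∀ i, ∃ (k : Fin 3 → ℤ) (a : EuclideanSpace ℝ (Fin 3)) (c : Bool),
      ((F.b i : Hsp) : Lp (EuclideanSpace ℝ (Fin 3)) 2 (volume : Measure (UnitAddTorus (Fin 3)))) = stokesModeL2 k a c ∧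
        F.m i = stokesEigenvalue k := fun i => by
    obtain ⟨k, a, c, -, -, -, hcoe, hmi⟩ := F.hmodes i
    exact ⟨k, a, c, hcoe, hmi⟩
  have hfb := tsum_one_add_stokesEigenvalue_mul_enorm_sq_le F.b F.m hb F.S F.hS y
  have hmem : MemLp (rep (F.S y)) 2 volume := Lp.memLp _
  have hpar : ∑' k : Fin 3 → ℤ, ‖UnitAddTorus.mFourierCoeff (EuclideanSpace.complexify ∘ rep (F.S y)) k‖ₑ ^ 2 =
      ENNReal.ofReal (‖F.S y‖ ^ 2) := by
    rw [stub_trajectoryPowerBudget_aux_norm_sq (F.S y) (ae_eq_refl _), integral_norm_sq_eq_tsum hmem,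
      ENNReal.ofReal_tsum_of_nonneg (fun k => sq_nonneg _) (hasSum_sq_norm_mFourierCoeff_complexify hmem).summable]
    refine tsum_congr fun k => ?_
    rw [← ofReal_norm, ← ENNReal.ofReal_pow (norm_nonneg _)]
  have hgrad : eGradNormSq (rep (F.S y)) = ∑' k : Fin 3 → ℤ, ENNReal.ofReal (stokesEigenvalue k) *
      ‖UnitAddTorus.mFourierCoeff (EuclideanSpace.complexify ∘ rep (F.S y)) k‖ₑ ^ 2 := by
    rw [eGradNormSq_eq_tsum, ← ENNReal.tsum_mul_left]
    refine tsum_congr fun k => ?_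
    rw [← mul_assoc, ← ENNReal.ofReal_mul (by positivity)]
    rfl
  have hsplit : ∑' k : Fin 3 → ℤ, ENNReal.ofReal (1 + stokesEigenvalue k) *
      ‖UnitAddTorus.mFourierCoeff (EuclideanSpace.complexify ∘ rep (F.S y)) k‖ₑ ^ 2 =
      ENNReal.ofReal (‖F.S y‖ ^ 2) + eGradNormSq (rep (F.S y)) := by
    rw [hgrad, ← hpar, ← ENNReal.tsum_add]
    refine tsum_congr fun k => ?_
    rw [ENNReal.ofReal_add zero_le_one (stokesEigenvalue_nonneg k), ENNReal.ofReal_one, add_mul, one_mul]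
  rw [← hsplit]
  exact hfb

/-- The enstrophy of the physical state of a frame vector is at most its squared frame norm: `‖∇ rep (F.S y)‖₂² ≤ ‖y‖²`.
[folklore] -/
theorem eGradNormSq_rep_le (F : ModelFrame) (y : Hsp) : eGradNormSq (rep (F.S y)) ≤ ENNReal.ofReal (‖y‖ ^ 2) :=
  le_trans (self_le_add_left _ _) (F.ofReal_norm_sq_add_eGradNormSq_le y)

/-! ## Convergence of frame preimages from `H¹` attainment -/

/-- **Frame preimages converge when the states are attained in `L²` and in `Ḣ¹`.**  Let `y ∈ H`, let `w s` (`s` along a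
filter `l`) be smooth divergence-free mean-zero fields with `∫‖w s − rep(F.S y)‖² → 0` and `‖∇(w s − rep(F.S y))‖₂² → 0`,
and let `Y s` be frame vectors with `F.S (Y s) = [w s]` (all eventually along `l`).  Then `Y s → y` in `H`: the coordinates
`⟪b i, Y s⟫ = (1 + m_i)^{1/2} ⟪b i, [w s]⟫` converge since `[w s] → F.S y`, and
`‖Y s‖² = ∫‖w s‖² + ‖∇ w s‖₂²` has `limsup ≤ ‖F.S y‖² + ‖∇ rep(F.S y)‖₂² ≤ ‖y‖²` (Peter–Paul and the frame bound).
[folklore] -/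
theorem tendsto_of_tendsto_stateOf (F : ModelFrame) {α : Type*} {l : Filter α}
    {w : α → (UnitAddTorus (Fin 3)) → (EuclideanSpace ℝ (Fin 3))} {y : Hsp} {Y : α → Hsp}
    (hw : ∀ᶠ s in l, IsSmooth (w s) ∧ IsDivFree (w s) ∧ HasZeroMean (w s) ∧ F.S (Y s) = stateOf (w s))
    (h0 : Tendsto (fun s => ∫ x, ‖w s x - rep (F.S y) x‖ ^ 2) l (𝓝 0))
    (h1 : Tendsto (fun s => eGradNormSq (w s - rep (F.S y))) l (𝓝 0)) :
    Tendsto Y l (𝓝 y) := by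
  -- the states converge in `H`
  have hst : Tendsto (fun s => F.S (Y s)) l (𝓝 (F.S y)) := by
    rw [tendsto_iff_norm_sub_tendsto_zero]
    have he : ∀ᶠ s in l, Real.sqrt (∫ x, ‖w s x - rep (F.S y) x‖ ^ 2) = ‖F.S (Y s) - F.S y‖ := by
      filter_upwards [hw] with s hs
      obtain ⟨hws, hwd, hwm, hY⟩ := hs
      have hrep : rep (stateOf (w s) - F.S y) =ᵐ[volume] fun x => w s x - rep (F.S y) x := by
        have h1 : rep (stateOf (w s) - F.S y) =ᵐ[volume] fun x => rep (stateOf (w s)) x - rep (F.S y) x := by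
          show (((stateOf (w s) - F.S y : Hsp) : Lp (EuclideanSpace ℝ (Fin 3)) 2
              (volume : Measure (UnitAddTorus (Fin 3)))) : (UnitAddTorus (Fin 3)) → (EuclideanSpace ℝ (Fin 3))) =ᵐ[volume] _
          rw [Submodule.coe_sub]
          exact Lp.coeFn_sub _ _
        filter_upwards [h1, rep_stateOf hws hwd hwm] with x hx h2
        rw [hx, h2]
      rw [hY, ← stub_trajectoryPowerBudget_aux_norm_sq _ hrep, Real.sqrt_sq (norm_nonneg _)]
    refine Tendsto.congr' he ?_
    have := h0.sqrt
    rwa [Real.sqrt_zero] at this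
  refine Literature.Analysis.InnerProduct.tendsto_of_forall_inner_hilbertBasis_tendsto F.b (fun i => ?_) fun δ hδ => ?_
  · -- coordinates
    obtain ⟨k, a, c, -, -, -, -, hmi⟩ := F.hmodes i
    have hm0 : 0 ≤ F.m i := hmi ▸ stokesEigenvalue_nonneg k
    have h1p : 0 < 1 + F.m i := by linarith
    have hσ0 : (1 + F.m i) ^ (-(1 / 2 : ℝ)) ≠ 0 := (Real.rpow_pos_of_pos h1p _).ne'
    have he : ∀ x : Hsp, ⟪F.b i, x⟫_ℝ = ((1 + F.m i) ^ (-(1 / 2 : ℝ)))⁻¹ * ⟪F.b i, F.S x⟫_ℝ := fun x => by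
      rw [inner_basis_apply_of_apply_basis F.b F.hS x i, ← mul_assoc, inv_mul_cancel₀ hσ0, one_mul]
    have hf : (fun s => ⟪F.b i, Y s⟫_ℝ) = fun s => ((1 + F.m i) ^ (-(1 / 2 : ℝ)))⁻¹ * ⟪F.b i, F.S (Y s)⟫_ℝ :=
      funext fun s => he _
    rw [hf, he y]
    exact (tendsto_const_nhds.inner hst).const_mul _
  · -- the norms: `‖Y s‖² = ∫‖w s‖² + ‖∇ w s‖₂²`, Peter–Paul, the frame bound
    set v : (UnitAddTorus (Fin 3)) → (EuclideanSpace ℝ (Fin 3)) := rep (F.S y) with hv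
    have hvint : Integrable v volume := (Lp.memLp (F.S y : Lp (EuclideanSpace ℝ (Fin 3)) 2
      (volume : Measure (UnitAddTorus (Fin 3))))).integrable one_le_two
    have hfb := F.ofReal_norm_sq_add_eGradNormSq_le y
    have hEv : eGradNormSq v ≠ ∞ := ne_top_of_le_ne_top (by simp)
      (le_trans (self_le_add_left _ _) hfb)
    have hfb' : ‖F.S y‖ ^ 2 + (eGradNormSq v).toReal ≤ ‖y‖ ^ 2 := by
      have h := ENNReal.toReal_mono ENNReal.ofReal_ne_top hfb
      rwa [ENNReal.toReal_add ENNReal.ofReal_ne_top hEv, ENNReal.toReal_ofReal (sq_nonneg _),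
        ENNReal.toReal_ofReal (sq_nonneg _)] at h
    have hEvle : (eGradNormSq v).toReal ≤ ‖y‖ ^ 2 := by nlinarith [norm_nonneg (F.S y)]
    -- the Peter–Paul parameter
    set δ₁ : ℝ := δ / (3 * (‖y‖ ^ 2 + 1)) with hδ₁
    have hδ₁0 : 0 < δ₁ := by positivity
    have hδ₁E : δ₁ * (eGradNormSq v).toReal ≤ δ / 3 := by
      rw [hδ₁, div_mul_eq_mul_div, div_le_div_iff₀ (by positivity) (by norm_num : (0 : ℝ) < 3)]
      nlinarith [ENNReal.toReal_nonneg (a := eGradNormSq v)]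
    -- eventually the two attainment quantities are small
    have hc0 : 0 < δ / 3 / (1 + δ₁⁻¹) := by positivity
    have hev1 : ∀ᶠ s in l, eGradNormSq (w s - v) < ENNReal.ofReal (δ / 3 / (1 + δ₁⁻¹)) :=
      h1.eventually (gt_mem_nhds (ENNReal.ofReal_pos.2 hc0))
    have hev0 : ∀ᶠ s in l, ‖F.S (Y s)‖ ^ 2 < ‖F.S y‖ ^ 2 + δ / 3 :=
      ((continuous_pow 2).continuousAt.tendsto.comp hst.norm).eventually (gt_mem_nhds (by linarith))
    filter_upwards [hev0, hev1, hw] with s hs0 hs1 hs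
    obtain ⟨hws, hwd, hwm, hY⟩ := hs
    rw [hY] at hs0
    have hfin : eGradNormSq (w s - v) ≠ ∞ := hs1.ne_top
    have hPP := eGradNormSq_le_add_mul_eGradNormSq_sub hws.integrable hvint hδ₁0
    have hws' : eGradNormSq (w s) ≠ ∞ := ne_top_of_le_ne_top
      (ENNReal.add_ne_top.2 ⟨ENNReal.mul_ne_top ENNReal.ofReal_ne_top hEv,
        ENNReal.mul_ne_top ENNReal.ofReal_ne_top hfin⟩) hPP
    have hPP' : gradNormSq (w s) ≤ (1 + δ₁) * (eGradNormSq v).toReal + (1 + δ₁⁻¹) * (eGradNormSq (w s - v)).toReal := by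
      have h := ENNReal.toReal_mono (ENNReal.add_ne_top.2 ⟨ENNReal.mul_ne_top ENNReal.ofReal_ne_top hEv,
        ENNReal.mul_ne_top ENNReal.ofReal_ne_top hfin⟩) hPP
      rwa [ENNReal.toReal_add (ENNReal.mul_ne_top ENNReal.ofReal_ne_top hEv)
        (ENNReal.mul_ne_top ENNReal.ofReal_ne_top hfin), ENNReal.toReal_mul, ENNReal.toReal_mul,
        ENNReal.toReal_ofReal (by positivity), ENNReal.toReal_ofReal (by positivity),
        ← gradNormSq_eq_toReal_eGradNormSq_holds hws] at h
    have hsm : (1 + δ₁⁻¹) * (eGradNormSq (w s - v)).toReal ≤ δ / 3 := by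
      have h := (ENNReal.toReal_mono ENNReal.ofReal_ne_top hs1.le)
      rw [ENNReal.toReal_ofReal hc0.le, le_div_iff₀ (by positivity)] at h
      linarith
    rw [F.norm_sq_eq_of_apply_eq_stateOf hws hwd hwm hY, ← norm_stateOf_sq hws hwd hwm]
    nlinarith [ENNReal.toReal_nonneg (a := eGradNormSq v)]

end ModelFrame

/-! ## Identification of mild orbits with classical trajectories -/

/-- **Identification of a mild orbit with a classical trajectory attaining its datum** (tools lemma of S6g).  Let `ζ` be
a mild solution of the frame-conjugated equation on `[0, τ]` from `y`, bounded by `B`, and let `(w, q)` be a classical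
solution of NS_ν(f_c) on `(0, L] × T³` with mean-zero slices, `‖∇w(s)‖₂² ≤ M`, attaining `rep (F.S y)` in `L²` and in
`Ḣ¹` as `s → 0⁺`.  Then `F.S (ζ s) = [w s]` for `s ∈ [0, τ] ∩ (0, L]`.  Proof: the frame curve `Y s = S([w s] − [Δ w s])`
(`F.S (Y s) = [w s]`, S6₁) is bounded (`‖Y s‖² = ∫‖w s‖² + ‖∇w s‖₂² ≤ 2M`, Poincaré) and solves the mild equation from
`Y ε` on `[ε, L]` for every `ε > 0` (S5b), while `r ↦ ζ(ε + r)` solves it from `ζ ε`; Lipschitz dependence on the datum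
gives `‖ζ s − Y s‖ ≤ Lip ‖ζ ε − Y ε‖`, and `ζ ε → y`, `Y ε → y` (`tendsto_of_tendsto_stateOf`) as `ε → 0⁺`. [folklore] -/
theorem stub_mildOrbitIdentificationTools
    {S : Finset (Fin 3 → ℤ)} {c : ↥S → (EuclideanSpace ℂ (Fin 3))} {ν : ℝ} (hν : 0 < ν)
    (F : ModelFrame) (xF : Hsp) (hxF : F.S xF = stateOf (force S c)) {B M τ L : ℝ} (hτ : 0 ≤ τ) (hL : 0 < L)
    {y : Hsp} {ζ : C(Icc (0 : ℝ) τ, Hsp)} (hζ : F.IsMild ν xF hτ y ζ) (hζB : ∀ r, ‖ζ r‖ ≤ B)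
    {w : ℝ → (UnitAddTorus (Fin 3)) → (EuclideanSpace ℝ (Fin 3))} {q : ℝ → (UnitAddTorus (Fin 3)) → ℝ}
    (hw : IsClassicalNSSolutionOn (Ioc 0 L) ν (fun _ => force S c) w q) (hwm : ∀ s ∈ Ioc 0 L, HasZeroMean (w s))
    (hwM : ∀ s ∈ Ioc 0 L, gradNormSq (w s) ≤ M)
    (h0 : Tendsto (fun s => ∫ x, ‖w s x - rep (F.S y) x‖ ^ 2) (𝓝[>] 0) (𝓝 0))
    (h1 : Tendsto (fun s => eGradNormSq (w s - rep (F.S y))) (𝓝[>] 0) (𝓝 0)) :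
    ∀ (s : ℝ) (hs : s ∈ Icc 0 τ), s ∈ Ioc 0 L → F.S (ζ ⟨s, hs⟩) = stateOf (w s) := by
  obtain ⟨hFs, hFd, hFm⟩ := stub_designerForceTools S c
  -- honest slices and the frame curve
  have hws : ∀ s ∈ Ioc 0 L, IsSmooth (w s) := fun s hs => hw.smooth_velocity.isSmooth_slice hs
  set Y : ℝ → Hsp := fun s => F.S (stateOf (w s) - stateOf (laplacian (w s))) with hYdef
  have hSY : ∀ s ∈ Ioc 0 L, F.S (Y s) = stateOf (w s) := fun s hs =>
    stub_framePreimageTools F.ι F.b F.m F.hmodes F.S F.hS (hws s hs) (hw.divFree s hs) (hwm s hs)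
  -- the bound of the frame curve
  have hYB : ∀ s ∈ Ioc 0 L, ‖Y s‖ ≤ Real.sqrt (2 * M) := by
    intro s hs
    have hP := four_pi_sq_mul_integral_norm_sq_le_gradNormSq (hws s hs) (hwm s hs)
    have hπ : (1 : ℝ) ≤ 4 * Real.pi ^ 2 := by nlinarith [Real.pi_gt_three]
    have hI : 0 ≤ ∫ x, ‖w s x‖ ^ 2 := integral_nonneg fun _ => sq_nonneg _
    have h2 : ‖Y s‖ ^ 2 ≤ 2 * M := by
      rw [F.norm_sq_eq_of_apply_eq_stateOf (hws s hs) (hw.divFree s hs) (hwm s hs) (hSY s hs)]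
      nlinarith [hwM s hs]
    exact Real.le_sqrt_of_sq_le h2
  set R : ℝ := max B (Real.sqrt (2 * M)) with hR
  obtain ⟨Lip, -, hLip⟩ := F.exists_forall_isMild_norm_sub_le hν xF R L
  -- the two curves tend to `y` as `ε → 0⁺`
  have hmem : ∀ᶠ ε in 𝓝[>] (0 : ℝ), ε ∈ Ioc 0 L := Ioc_mem_nhdsGT hL
  have hYt : Tendsto Y (𝓝[>] 0) (𝓝 y) :=
    F.tendsto_of_tendsto_stateOf (hmem.mono fun ε hε => ⟨hws ε hε, hw.divFree ε hε, hwm ε hε, hSY ε hε⟩) h0 h1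
  have hζt : Tendsto (fun ε => ζ (projIcc 0 τ hτ ε)) (𝓝[>] 0) (𝓝 y) := by
    have hc : Continuous fun ε => ζ (projIcc 0 τ hτ ε) := ζ.continuous.comp continuous_projIcc
    have h := (hc.tendsto 0).mono_left (nhdsWithin_le_nhds (s := Ioi 0))
    simp only [projIcc_left] at h
    rwa [hζ.apply_zero] at h
  -- the comparison on `[ε, s]`
  intro s hs hsL
  have key : ∀ ε ∈ Ioo 0 s, ‖ζ ⟨s, hs⟩ - Y s‖ ≤ Lip * ‖ζ (projIcc 0 τ hτ ε) - Y ε‖ := by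
    intro ε hε
    have hε0 : 0 ≤ ε := hε.1.le
    have hsε : 0 ≤ s - ε := sub_nonneg.2 hε.2.le
    have hεL : ε < L := hε.2.trans_le hsL.2
    -- the shifted mild orbit
    obtain ⟨ζ', hζ', hζ'eq⟩ := hζ.restrict hs.1 hs.2
    obtain ⟨w₁, hw₁, hw₁eq⟩ := hζ'.shift hν hε0 hsε (sub_add_cancel s ε)
    -- the shifted frame curve is mild from `Y ε` (S5b on `[ε, L]`)
    have hsol' : IsClassicalNSSolutionOn (Icc ε (ε + (L - ε))) ν (fun _ => force S c) w q := by
      rw [add_sub_cancel]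
      exact hw.mono (fun r hr => ⟨hε.1.trans_le hr.1, hr.2⟩) (uniqueDiffOn_Icc hεL)
    have hI : ∀ r ∈ Icc (0 : ℝ) (L - ε), ε + r ∈ Ioc 0 L := fun r hr => ⟨by linarith [hε.1, hr.1], by linarith [hr.2]⟩
    have hmean' : ∀ r ∈ Icc ε (ε + (L - ε)), HasZeroMean (w r) := fun r hr =>
      hwm r ⟨hε.1.trans_le hr.1, by linarith [hr.2]⟩
    have hy' : ∀ r ∈ Icc (0 : ℝ) (L - ε), F.S (Y (ε + r)) = stateOf (w (ε + r)) := fun r hr => hSY _ (hI r hr)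
    have hYm := stub_conjugatedMildIdentityTools F.ι F.b F.m F.hpos F.hmodes F.S F.hS F.T F.K F.hT F.hTnorm F.hTsa
      F.hTc F.hK F.hKnorm F.hKc F.Nb F.hNb hν hFs hFd hFm (sub_pos.2 hεL) hsol' hmean' (fun r => Y (ε + r)) hy' xF hxF
    have hYc : ContinuousOn (fun r => Y (ε + r)) (Icc 0 (L - ε)) :=
      continuousOn_frameCurve F.b F.hmodes F.hS (sub_pos.2 hεL) hsol' hmean' hy'
    obtain ⟨z₂, hz₂, hz₂eq⟩ := exists_mild_of_eqOn (fun t => F.T (ν * t)) (fun t => F.K (ν * t)) F.Nb xF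
      (Y := fun r => Y (ε + r)) (y := Y ε) hYc
      (fun r hr => by have h := hYm r hr; rwa [add_zero] at h) hsε (by linarith [hs.2, hsL.2] : s - ε ≤ L - ε)
    have hz₂' : F.IsMild ν xF hsε (Y ε) z₂ := hz₂
    -- bounds and the Lipschitz estimate
    have hb₁ : ∀ r, ‖w₁ r‖ ≤ R := fun r => by
      rw [hw₁eq r, hζ'eq]
      exact (hζB _).trans (le_max_left _ _)
    have hb₂ : ∀ r : Icc (0 : ℝ) (s - ε), ‖z₂ r‖ ≤ R := fun r => by
      rw [hz₂eq r]
      exact (hYB _ (hI r ⟨r.2.1, r.2.2.trans (by linarith [hs.2, hsL.2])⟩)).trans (le_max_right _ _)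
    have h := hLip hsε (by linarith [hε.1, hsL.2]) hw₁ hz₂' hb₁ hb₂ ⟨s - ε, hsε, le_rfl⟩
    have eq1 : w₁ ⟨s - ε, hsε, le_rfl⟩ = ζ ⟨s, hs⟩ := by
      rw [hw₁eq]
      simp only [add_sub_cancel, projIcc_right, hζ'eq]
    have eq2 : z₂ ⟨s - ε, hsε, le_rfl⟩ = Y s := by
      rw [hz₂eq]
      simp only [add_sub_cancel]
    have eq3 : ζ' ⟨ε, hε0, (le_add_of_nonneg_left hsε).trans_eq (sub_add_cancel s ε)⟩ = ζ (projIcc 0 τ hτ ε) := by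
      rw [hζ'eq, projIcc_of_mem hτ ⟨hε0, hε.2.le.trans hs.2⟩]
    rw [eq1, eq2, eq3] at h
    exact h
  -- `ε → 0⁺`
  have hlim : Tendsto (fun ε => Lip * ‖ζ (projIcc 0 τ hτ ε) - Y ε‖) (𝓝[>] 0) (𝓝 0) := by
    have h := ((hζt.sub hYt).norm).const_mul Lip
    rwa [sub_self, norm_zero, mul_zero] at h
  have hle : ‖ζ ⟨s, hs⟩ - Y s‖ ≤ 0 :=
    ge_of_tendsto hlim (eventually_of_mem (Ioo_mem_nhdsGT hsL.1) key)
  rw [← hSY s hsL, ← sub_eq_zero.1 (norm_le_zero_iff.1 hle)]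


end Summit.AnomalousDissipation.AnomalousDissipation.Theorems.DenseLoudDesignerForces.Ergodic

end
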